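import Summits.ResolutionOfSingularities.ResolutionOfSingularities.Theorems.FrobeniusClosingPatchingRelPerfectDepthOneExceptionalDivisor
import Literature.AlgebraicGeometry.Motives.ProjectiveNoetherNormalization
import HarnessLib

/-!
# Crux `PatchingRelPerfect` (stmt-ResolutionOfSingularities-16161), chain w52 — programme r-d1,
# piece I1 (`ExceptionalPackage`), part 3: the exceptional divisor of the point blow-up of a
# regular local ring of dimension `m + 1` has dimension `m`

[OURS · L1 W5.2 · rung tool] CHAIN.md v1.5 §2 (row stub-3, last field; volunteer hand res-D-pv-055).
For a quasi-regular sequence `y = (y₀, …, y_m)` in a ring `S` generating a MAXIMAL ideal `𝔪`,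
`X = Bl_𝔪 Spec S` (`affineBlowup 𝔪`, `g = affineBlowup.π 𝔪`) and the exceptional divisor
`E = V(𝔪𝒪_X)` (`((𝔪~).comap g).subscheme`), PROVED:

* `topologicalKrullDim_exceptional_of_isQuasiRegular` — **`dim E = m`**: `E` and the fibre product
  `X ×_{Spec S} Spec (S/𝔪)` are closed subschemes of `X` with the same support `g⁻¹(𝔪)`, hence
  homeomorphic; the latter IS `ℙᵐ_{S/𝔪}` (tree `isPullback_exceptional_projectiveSpace`,
  Hartshorne II 8.24 (b) in chart form, pasted with `ℙᵐ_{S/𝔪} = ℙᵐ_S ×_S Spec (S/𝔪)`,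
  `isPullback_projMap'`), and `dim ℙᵐ_κ = m` (`ProjSpace.topologicalKrullDim_eq`);
* `topologicalKrullDim_exceptional` — the same for a regular system of parameters of a regular
  local ring (quasi-regular by Matsumura 17.10, `isQuasiRegular_regularSystemOfParameters`).

Nothing here is a statement of the manuscript under review.

## References

* R. Hartshorne, *Algebraic Geometry* (1977), II Thm. 8.24 (b). [Hartshorne1977]
* Q. Liu, *Algebraic Geometry and Arithmetic Curves* (2002), Thm. 8.1.19 (b). [Liu2002]
* U. Görtz, T. Wedhorn, *Algebraic Geometry I*, 2nd ed. (2020), Cor. 5.18. [GortzWedhorn2020]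
-/

-- `Summit.<Summit>.<Sub>.Theorems` with `Sub = Summit` (single-conjunct summit, D-0017)
set_option linter.dupNamespace false

noncomputable section

open CategoryTheory CategoryTheory.Limits AlgebraicGeometry Literature.AlgebraicGeometry.Resolution
open IsLocalRing TopologicalSpace
open Literature.AlgebraicGeometry.Motives Literature.AlgebraicGeometry.Motives.ProjBaseChangeRing

namespace Summit.ResolutionOfSingularities.ResolutionOfSingularities.Theorems

namespace DepthOne

universe u

/-- Two topological embeddings with the same range have homeomorphic sources, hence the same
topological Krull dimension. [folklore] -/
theorem topologicalKrullDim_eq_of_isEmbedding_of_range_eq {A B C : Type*} [TopologicalSpace A]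
    [TopologicalSpace B] [TopologicalSpace C] {f : A → C} {f' : B → C}
    (hf : Topology.IsEmbedding f) (hf' : Topology.IsEmbedding f') (h : Set.range f = Set.range f') :
    topologicalKrullDim A = topologicalKrullDim B :=
  IsHomeomorph.topologicalKrullDim_eq _
    ((hf.toHomeomorph.trans (Homeomorph.setCongr h)).trans hf'.toHomeomorph.symm).isHomeomorph

section Exceptional

variable {S : Type u} [CommRing S] {m : ℕ} (y : Fin (m + 1) → S)

local notation3 "M" => Ideal.span (Set.range y)
local notation3 "X" => affineBlowup (Ideal.span (Set.range y))
local notation3 "g" => affineBlowup.π (Ideal.span (Set.range y))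
local notation3 "𝓔" => (affineBlowup.idealSheaf (Ideal.span (Set.range y))).comap
  (affineBlowup.π (Ideal.span (Set.range y)))

/-- The support of the exceptional ideal `𝔪𝒪_X` is the fibre of `g` over the point `𝔪`
(for `𝔪 = (y)` maximal). [folklore] -/
theorem support_exceptional_eq_preimage (hmax : (M).IsMaximal) :
    ((𝓔).support : Set X) = (g) ⁻¹' {(⟨M, hmax.isPrime⟩ : PrimeSpectrum S)} := by
  rw [Scheme.IdealSheafData.support_comap, Closeds.coe_preimage, affineBlowup.support_idealSheaf]
  congr 1
  ext p
  change (M : Set S) ⊆ p.asIdeal ↔ p = _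
  constructor
  · intro h
    exact PrimeSpectrum.ext (hmax.eq_of_le p.2.ne_top h).symm
  · rintro rfl; exact le_rfl

/-- The closed immersion `Spec (S/𝔪) → Spec S` has range the point `𝔪` (for `𝔪 = (y)` maximal).
[folklore] -/
theorem range_specMap_quotient_mk (hmax : (M).IsMaximal) :
    Set.range (Spec.map (CommRingCat.ofHom (Ideal.Quotient.mk (M)))) =
      {(⟨M, hmax.isPrime⟩ : PrimeSpectrum S)} := by
  refine Set.eq_singleton_iff_unique_mem.mpr ⟨⟨⟨⊥, ?_⟩, ?_⟩, ?_⟩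
  · letI := Ideal.Quotient.field (M)
    exact Ideal.isPrime_bot
  · apply PrimeSpectrum.ext
    rw [Spec.map_apply, CommRingCat.hom_ofHom, PrimeSpectrum.comap_asIdeal, ← RingHom.ker_eq_comap_bot,
      Ideal.mk_ker]
  · rintro _ ⟨q, rfl⟩
    apply PrimeSpectrum.ext
    have hle : M ≤ (Spec.map (CommRingCat.ofHom (Ideal.Quotient.mk (M))) q).asIdeal := by
      intro a ha
      rw [Spec.map_apply, CommRingCat.hom_ofHom, PrimeSpectrum.comap_asIdeal, Ideal.mem_comap,
        Ideal.Quotient.eq_zero_iff_mem.mpr ha]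
      exact zero_mem _
    exact (hmax.eq_of_le (PrimeSpectrum.isPrime _).ne_top hle).symm

/-- **`dim E = m`** for the exceptional divisor `E = V(𝔪𝒪_X) ⊂ X = Bl_𝔪 Spec S` of the blow-up
along a maximal ideal `𝔪 = (y₀, …, y_m)` generated by a QUASI-REGULAR sequence: `E` is
homeomorphic to `X ×_{Spec S} Spec (S/𝔪) ≅ ℙᵐ_{S/𝔪}` (Hartshorne II 8.24 (b)), of dimension `m`.
[cite: Hartshorne1977, II Thm. 8.24 (b)] [cite: GortzWedhorn2020, Cor. 5.18 (p. 156)] -/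
theorem topologicalKrullDim_exceptional_of_isQuasiRegular (hqr : IsQuasiRegular y)
    (hmax : (M).IsMaximal) : topologicalKrullDim (𝓔).subscheme = m := by
  classical
  letI : Field (S ⧸ M) := Ideal.Quotient.field _
  -- the standard gradings of `S[T₀, …, T_m]` and `(S/𝔪)[T₀, …, T_m]` (Mathlib keeps them `def`s;
  -- used as instances inside this proof only)
  letI : GradedRing (MvPolynomial.homogeneousSubmodule (Fin (m + 1)) S) :=
    MvPolynomial.gradedAlgebra
  letI : GradedRing (MvPolynomial.homogeneousSubmodule (Fin (m + 1)) (S ⧸ M)) :=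
    MvPolynomial.gradedAlgebra
  -- the closed immersion `j : Spec (S/𝔪) → Spec S`, with kernel `𝔪~`
  haveI hj : IsClosedImmersion (Spec.map (CommRingCat.ofHom (Ideal.Quotient.mk (M)))) :=
    IsClosedImmersion.spec_of_surjective _ Ideal.Quotient.mk_surjective
  have hjker : (Spec.map (CommRingCat.ofHom (Ideal.Quotient.mk (M)))).ker =
      affineBlowup.idealSheaf (M) := by
    rw [ker_specMap_eq_idealSheaf, Ideal.mk_ker]
  -- `X ×_{Spec S} Spec (S/𝔪) ≅ ℙᵐ_{S/𝔪}`
  have h1 := isPullback_exceptional_projectiveSpace y _ hjker hqr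
  have h2 := isPullback_projMap' S (S ⧸ M) (n := m)
  rw [Ideal.Quotient.algebraMap_eq] at h2
  let e := h1.isoIsPullback _ _ h2
  have hP : topologicalKrullDim
      ↑(pullback (g) (Spec.map (CommRingCat.ofHom (Ideal.Quotient.mk (M))))) = m := by
    rw [IsHomeomorph.topologicalKrullDim_eq _ (Scheme.homeoOfIso e).isHomeomorph]
    exact ProjSpace.topologicalKrullDim_eq m (S ⧸ M)
  -- `E` and the fibre product are closed subschemes of `X` with the same support
  have hrange : Set.range (𝓔).subschemeι =
      Set.range (pullback.fst (g) (Spec.map (CommRingCat.ofHom (Ideal.Quotient.mk (M))))) := by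
    rw [Scheme.IdealSheafData.range_subschemeι, Scheme.Pullback.range_fst,
      range_specMap_quotient_mk y hmax, support_exceptional_eq_preimage y hmax]
  rw [topologicalKrullDim_eq_of_isEmbedding_of_range_eq (𝓔).subschemeι.isClosedEmbedding.isEmbedding
    (pullback.fst (g) (Spec.map (CommRingCat.ofHom
      (Ideal.Quotient.mk (M))))).isClosedEmbedding.isEmbedding hrange]
  exact hP

/-- **`dim E = m` for the point blow-up of a regular local ring** with regular system of parameters
`y = (y₀, …, y_m)` (so `dim S = m + 1`): the last field of plan-1's `ExceptionalPackage`.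
[cite: Hartshorne1977, II Thm. 8.24 (b)] [cite: GortzWedhorn2020, Cor. 5.18 (p. 156)] -/
theorem topologicalKrullDim_exceptional [IsRegularLocalRing S]
    (hy : Ideal.span (Set.range y) = IsLocalRing.maximalIdeal S)
    (hd : (IsLocalRing.maximalIdeal S).spanFinrank = m + 1) :
    topologicalKrullDim (𝓔).subscheme = m :=
  topologicalKrullDim_exceptional_of_isQuasiRegular y
    (isQuasiRegular_regularSystemOfParameters hd y hy) (hy ▸ IsLocalRing.maximalIdeal.isMaximal S)

end Exceptional

end DepthOne

end Summit.ResolutionOfSingularities.ResolutionOfSingularities.Theorems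

end
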